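import Literature.AlgebraicGeometry.ShimuraVarieties.UnitaryShimuraCurveEmbeddedImageStable
import Literature.AlgebraicGeometry.Motives.ClosedSubschemeTowerLift
import HarnessLib

/-!
# The DESCENDED TOWER of the embedded unitary Shimura curve inside the canonical model of the
# compact unitary Shimura surface

Topic `AlgebraicGeometry/ShimuraVarieties`, namespace `…ShimuraVarieties.UnitaryCanonicalModel`.  THEOREMS ONLY (no
definition, no named fact, no instance, no `sorry`).  Cell `hodgecm-mathlib`, road (ii) «embedded-curve descent» of the census
«GS-3 ⇐ #62» (A-p10 g7), leaf R2-5 (tower half): books 0 — nothing here is a proof of GS-3.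

DATA.  A rank-3 canonical-model record system ★ `R : RecordSystem L H τ T hT K₀'` (models `M_K` over the CM field `L` of the
compact unitary Shimura SURFACE), a frame `ᵗ(cB)·(a·H)·B = J⋆ ⊕ J⊥` (`τ a` a positive real; ★ `φGS = R_B ∘ (· ⊕ 1)`), and — for the
tower — ANY functor of small levels `Tl : SmallLevel K₀⋆ ⥤ SmallLevel K₀'` from curve levels `K⋆ ≤ K₀⋆ ≤ U(J⋆)(𝔸_{L⁺,f})` to
surface levels with `φGS(K⋆) ≤ Tl K⋆` (e.g. the trace levels of ★ `exists_smallLevelFunctor_comap_φGS_eq`).  For a curve level `K⋆`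
and a surface level `K` with `φGS(K⋆) ≤ K` write `C(K⋆, K) ⊆ (M_K)_τ` for the ZARISKI CLOSURE of the underlying points of the
embedded curve `{baseChangeEquiv τ (pts_K⁻¹ (embPoints P)) : P ∈ Sh_{K⋆}(U(J⋆))(ℂ)}` (★ `ShimuraSetGS.embPoints`).

RESULTS.
* §0 `Motives.exists_functor_along_of_forall_range_subset` — ★ `Motives.exists_functor_of_forall_range_subset` (towers of REDUCED
  closed subschemes assemble into a functor) for a diagram `Tl ⋙ M`, conclusions read componentwise over `M (Tl c)` (generic).
* §1 `RecordSystem.image_closure_embPoints_subset` — **the surface transitions carry closures into closures**: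
  `(M(f) ⊗ ℂ)(C(K⋆, K)) ⊆ C(K⋆′, K′)` for every transition `f : K ⟶ K′` of the surface record and ANY curve levels `K⋆, K⋆′`
  (the embedded image does not depend on the curve level): continuity of `M(f) ⊗ ℂ` for the Zariski topology, the points
  formula of the surface record (★ `RecordSystem.map_pts`: `M(f)[z, bK] = [z, bK′]`) and ★ `ShimuraSetGS.embPoints_mk`;
  `RecordSystem.range_comp_map_subset_of_range_eq_closure_embPoints` — the same read over `L` for closed `L`-subschemes
  `Z ↪ M_K`, `Z′ ↪ M_{K′}` with those closures as complex images (★ `Motives.range_subset_of_baseChangeHom`).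
* §2 `RecordSystem.exists_descendedTower` — **R2-5 (tower half), THE `L`-TOWER OF THE EMBEDDED CURVE**: there are a functor
  `M⋆ : SmallLevel K₀⋆ ⥤ SchemeOver L`, a natural transformation of closed immersions `ι : M⋆ ⟶ Tl ⋙ M` such that every
  `(M⋆_{K⋆})_τ` is REDUCED with underlying set `|ι_{K⋆} ⊗ ℂ| = C(K⋆, Tl K⋆)` exactly — levelwise ★
  `RecordSystem.exists_closedSubscheme_baseChange_range_eq_closure_embPoints` (R2-4: Galois descent of the stable closure,
  [Deligne1971TravauxShimura] Cor. 5.7), assembled into a functor by ★ `Motives.exists_functor_of_forall_range_subset` (the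
  transitions of REDUCED closed subschemes are unique, [Deligne1971TravauxShimura] Variante 5.9; here in the componentwise form
  `exists_functor_along_of_forall_range_subset` along the level functor `Tl`) once §1 is moved from `ℂ` to `L` by ★
  `Motives.range_subset_of_baseChangeHom`.

What is NOT here (later leaves of road (ii)): the record fields of `M⋆` (points `(M⋆_{K⋆})_τ(ℂ) ≃ₜ Sh_{K⋆}(ℂ)` at injective
levels, smoothness, uniformisation, reciprocity — R2-5 fields half / R2-7), injectivity of `embPoints` (R2-1-inj), GS-3 itself.

## References
* [Deligne1971TravauxShimura] P. Deligne, *Travaux de Shimura*, Sém. Bourbaki 389 (1971): 5.2 p. 155, Cor. 5.7 p. 156, Variante 5.9 p. 157.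
* [Milne2005ShimuraVarieties] J. S. Milne, *Introduction to Shimura varieties* (2005/2017): Lemma 5.13 p. 57, Thm. 5.16 p. 59, §13 pp. 117–119 (Thm. 13.6, Rem. 13.8).
* [Liu2021] Y. Liu, *Fourier–Jacobi cycles and arithmetic relative trace formula*, Camb. J. Math. 9 (2021), proof of Thm. 4.15 (FJcycle.tex l. 2193–2208).
* [Margulis1991] G. A. Margulis, *Discrete subgroups of semisimple Lie groups* (1991), Ch. I (0.11) p. 17.
* [GortzWedhorn2020] U. Görtz, T. Wedhorn, *Algebraic Geometry I* (2nd ed. 2020), Prop. 4.32 (reduced subschemes; unique factorisation).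
* [StacksProject] The Stacks Project, Tag 01S1 (surjectivity is stable under base change), Tag 0356.
-/

noncomputable section

open Function Topology NumberField CategoryTheory Matrix AlgebraicGeometry
open scoped Matrix ComplexOrder
open Literature.AlgebraicGeometry.Motives Literature.NumberTheory.Automorphic Literature.NumberTheory.Automorphic.UnitaryGroup
open Literature.NumberTheory.Automorphic.Liu2021.AppendixC (C5.OpenCompactSubgroup C5.SmallLevel)
open Literature.Geometry.ComplexHyperbolic Literature.Geometry.ComplexHyperbolic.BallModel

/-! ### §0 Generic plumbing (base change `- ⊗_L ℂ` in the spelling `AbelianVariety.bcFunctor`; towers along a functor of indices) -/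

namespace Literature.AlgebraicGeometry.Motives

section Generic

variable {L : Type} [Field L]

/-- Naturality of `X(ℂ) ≃ X_τ(ℂ)` (`AlgPoints.baseChangeEquiv`) in the `L`-scheme `X`: `(f ⊗ ℂ)(x_τ) = (f x)_τ`
(in-file twin of the tree's `HodgeTheory.baseChangeEquiv_map`, kept private to spare the import). [folklore] -/
private theorem map_baseChangeEquiv_eq {τ : L →+* ℂ} {X Y : SchemeOver L} (f : X ⟶ Y)
    (x : letI : Algebra L ℂ := τ.toAlgebra; ComplexPoints X) :
    letI : Algebra L ℂ := τ.toAlgebra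
    AlgPoints.map ((Motives.baseChangeHom τ).map f) (AlgPoints.baseChangeEquiv τ X x) =
      AlgPoints.baseChangeEquiv τ Y (AlgPoints.map f x) := by
  letI : Algebra L ℂ := τ.toAlgebra
  symm
  rw [Equiv.apply_eq_iff_eq_symm_apply]
  apply Over.OverMorphism.ext
  rw [AlgPoints.baseChangeEquiv_symm_apply_left, AlgPoints.map_apply, Over.comp_left, AlgPoints.map_apply, Over.comp_left,
    Category.assoc, baseChangeHom_map_left_comp_fst, ← Category.assoc, AlgPoints.baseChangeEquiv_apply_left_comp_fst]
  rfl

/-- ★ `Motives.range_subset_of_baseChangeHom` in the spelling `AbelianVariety.bcFunctor L ℂ` of the canonical-model files: an image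
inclusion between `L`-morphisms may be checked after `- ⊗_L ℂ`. [cite: StacksProject, Tag 01S1] -/
private theorem range_subset_of_bcFunctor [Algebra L ℂ] {X Y W : SchemeOver L} (f : X ⟶ W) (g : Y ⟶ W)
    (h : Set.range ⇑((AbelianVariety.bcFunctor L ℂ).map g).left ⊆ Set.range ⇑((AbelianVariety.bcFunctor L ℂ).map f).left) :
    Set.range ⇑g.left ⊆ Set.range ⇑f.left :=
  range_subset_of_baseChangeHom (algebraMap L ℂ) f g h

/-- Precomposing with an isomorphism does not change the underlying image of `j ⊗_L ℂ`. [folklore] -/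
private theorem range_bcFunctor_map_iso_hom_comp [Algebra L ℂ] {X Z W : SchemeOver L} (e : X ≅ Z) (j : Z ⟶ W) :
    Set.range ⇑((AbelianVariety.bcFunctor L ℂ).map (e.hom ≫ j)).left = Set.range ⇑((AbelianVariety.bcFunctor L ℂ).map j).left := by
  haveI : IsIso ((AbelianVariety.bcFunctor L ℂ).map e.hom).left :=
    inferInstanceAs (IsIso ((Over.forget _).map (((AbelianVariety.bcFunctor L ℂ).mapIso e).hom)))
  have hfun : (⇑((AbelianVariety.bcFunctor L ℂ).map (e.hom ≫ j)).left : _ → ↥((AbelianVariety.bcFunctor L ℂ).obj W).left) =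
      ⇑((AbelianVariety.bcFunctor L ℂ).map j).left ∘ ⇑((AbelianVariety.bcFunctor L ℂ).map e.hom).left := by
    funext x
    rw [Functor.map_comp, Over.comp_left]
    exact Scheme.Hom.comp_apply _ _ x
  rw [hfun, ((AbelianVariety.bcFunctor L ℂ).map e.hom).left.surjective.range_comp]

/-- `X ≅ Z` with `Z ⊗_L ℂ` reduced forces `X ⊗_L ℂ` reduced. [folklore] -/
private theorem isReduced_bcFunctor_obj_of_iso [Algebra L ℂ] {X Z : SchemeOver L} (e : X ≅ Z)
    [IsReduced ((AbelianVariety.bcFunctor L ℂ).obj Z).left] : IsReduced ((AbelianVariety.bcFunctor L ℂ).obj X).left := by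
  haveI : IsIso ((AbelianVariety.bcFunctor L ℂ).map e.hom).left :=
    inferInstanceAs (IsIso ((Over.forget _).map (((AbelianVariety.bcFunctor L ℂ).mapIso e).hom)))
  exact isReduced_of_isOpenImmersion ((AbelianVariety.bcFunctor L ℂ).map e.hom).left

/-- An isomorphism followed by a closed immersion is a closed immersion (on underlying schemes of `L`-schemes). [folklore] -/
private theorem isClosedImmersion_left_iso_hom_comp {X Z W : SchemeOver L} (e : X ≅ Z) (j : Z ⟶ W) [IsClosedImmersion j.left] :
    IsClosedImmersion (e.hom ≫ j).left := by
  haveI : IsIso e.hom.left := inferInstanceAs (IsIso ((Over.forget _).map e.hom))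
  rw [Over.comp_left]
  infer_instance

/-- **Towers of reduced closed subschemes along a functor of indices** — ★ `Motives.exists_functor_of_forall_range_subset` for a
diagram of the form `Tl ⋙ M`, with every conclusion read COMPONENTWISE over `M (Tl c)` (so that no object `(Tl ⋙ M).obj c` ever
meets `M.obj (Tl.obj c)` in a consumer's goal): closed immersions `j c : Z c ↪ M (Tl c)` of REDUCED `Z c` whose images are carried
into each other by the transitions assemble into a functor `M⋆` with natural closed immersions `ι c = e c ≫ j c : M⋆ c ↪ M (Tl c)`,
`e c : M⋆ c ≅ Z c`. [cite: Deligne1971TravauxShimura, Variante 5.9 p. 157] [cite: GortzWedhorn2020, Prop. 4.32] -/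
theorem exists_functor_along_of_forall_range_subset {S : Scheme} {C D : Type*} [Category C] [Category D]
    (Tl : C ⥤ D) (M : D ⥤ Over S) (Z : C → Over S) (j : ∀ c, Z c ⟶ M.obj (Tl.obj c))
    [hj0 : ∀ c, IsClosedImmersion (j c).left] [hZ : ∀ c, IsReduced (Z c).left]
    (h : ∀ ⦃c c' : C⦄ (f : c ⟶ c'), Set.range ⇑(j c ≫ M.map (Tl.map f)).left ⊆ Set.range ⇑(j c').left) :
    ∃ (Mstar : C ⥤ Over S) (ι : ∀ c, Mstar.obj c ⟶ M.obj (Tl.obj c)) (e : ∀ c, Mstar.obj c ≅ Z c),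
      (∀ ⦃c c' : C⦄ (f : c ⟶ c'), Mstar.map f ≫ ι c' = ι c ≫ M.map (Tl.map f)) ∧ ∀ c, (e c).hom ≫ j c = ι c := by
  have hj : ∀ c, IsClosedImmersion (show Z c ⟶ (Tl ⋙ M).obj c from j c).left := fun c => hj0 c
  obtain ⟨Mstar, ιN, e, -, he⟩ :=
    @exists_functor_of_forall_range_subset _ _ _ (Tl ⋙ M) Z (fun c => j c) hj hZ h
  refine ⟨Mstar, fun c => (e c).hom ≫ j c, e, fun c c' f => ?_, fun c => rfl⟩
  have hn := ιN.naturality f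
  rw [← he c, ← he c', Category.assoc] at hn
  exact hn

end Generic

end Literature.AlgebraicGeometry.Motives

namespace Literature.AlgebraicGeometry.ShimuraVarieties.UnitaryCanonicalModel

variable {L : Type} [Field L] [NumberField L] [IsCMField L]

variable {Jstar : Matrix (Fin 2) (Fin 2) L} {τ : L →+* ℂ}
  {H : Matrix (Fin 3) (Fin 3) L} {T : GL (Fin 3) ℂ} {hT : formCongr (starRingEnd ℂ) T (H.map τ) = BallModel.J}
  {K₀' : C5.OpenCompactSubgroup ↥(finAdelic (↥(maximalRealSubfield L)) L (IsCMField.complexConj L) 3 H)}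
  (R : RecordSystem L H τ T hT K₀')
  (Jperp : Matrix (Fin 1) (Fin 1) L) (B : GL (Fin 3) L) {a : L} (ha : a ≠ 0)
  (hB : formCongr ((IsCMField.complexConj L : L ≃ₐ[↥(maximalRealSubfield L)] L) : L →+* L) B (a • H) = finSum 2 1 Jstar Jperp)
  (hτa : 0 < (τ a).re) (hτa' : (τ a).im = 0)

/-! ### §1 The surface transitions carry the closure of the embedded curve into the closure -/

section Transition

set_option maxHeartbeats 400000 in -- instance-heavy adelic / Shimura-set statement: `whnf`/`isDefEq` time out at the default (as ★ `UnitaryShimuraCurveEmbeddedImageStable`)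
/-- **The surface transitions carry closures into closures.**  For a transition `f : K ⟶ K′` of small surface levels and ANY
curve levels `K⋆, K⋆′` with `φGS(K⋆) ≤ K`, `φGS(K⋆′) ≤ K′`, the complexified transition `M(f) ⊗_{L,τ} ℂ` maps the Zariski
closure `C(K⋆, K)` of the embedded curve into `C(K⋆′, K′)`: `M(f) ⊗ ℂ` is continuous, acts on complex points through
`AlgPoints.map` (naturality of `baseChangeEquiv`), and on classes by the points formula `M(f)[z, bK] = [z, bK′]` of the record
(★ `RecordSystem.map_pts`), while `embPoints [v, uK⋆] = [𝔹(B^τ(v ⊕ 0)), φGS(u)K]` (★ `ShimuraSetGS.embPoints_mk`) — so the image of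
an embedded point of level `(K⋆, K)` is the embedded point `[v, uK⋆′] ↦ [𝔹(B^τ(v ⊕ 0)), φGS(u)K′]` of level `(K⋆′, K′)`.
[cite: Milne2005ShimuraVarieties, Thm. 5.16 p. 59, §13 p. 117 (60)–(62)] [cite: Deligne1971TravauxShimura, Variante 5.9 p. 157] -/
theorem RecordSystem.image_closure_embPoints_subset
    (Kstar Kstar' : Subgroup ↥(finAdelic (↥(maximalRealSubfield L)) L (IsCMField.complexConj L) 2 Jstar))
    (K K' : C5.SmallLevel K₀') (f : K ⟶ K')
    (hK : Kstar.map (φGS L Jstar Jperp H B ha hB) ≤ K.1.1) (hK' : Kstar'.map (φGS L Jstar Jperp H B ha hB) ≤ K'.1.1) :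
    letI : Algebra L ℂ := τ.toAlgebra
    ⇑((AbelianVariety.bcFunctor L ℂ).map (R.M.map f)).left ''
        closure (AlgPoints.pt '' Set.range fun P : ShimuraSetGS L Jstar τ Kstar =>
          AlgPoints.baseChangeEquiv τ (R.M.obj K) ((R.pts K).symm
            (ShimuraSetGS.embPoints L H τ T hT Jstar Jperp B ha hB hτa hτa' Kstar K.1.1 hK P))) ⊆
      closure (AlgPoints.pt '' Set.range fun P : ShimuraSetGS L Jstar τ Kstar' =>
          AlgPoints.baseChangeEquiv τ (R.M.obj K') ((R.pts K').symm
            (ShimuraSetGS.embPoints L H τ T hT Jstar Jperp B ha hB hτa hτa' Kstar' K'.1.1 hK' P))) := by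
  letI : Algebra L ℂ := τ.toAlgebra
  refine (image_closure_subset_closure_image
    ((AbelianVariety.bcFunctor L ℂ).map (R.M.map f)).left.continuous).trans (closure_mono ?_)
  rintro _ ⟨_, ⟨_, ⟨P, rfl⟩, rfl⟩, rfl⟩
  obtain ⟨v, hv, u, rfl⟩ := ShimuraSetGS.mk_surjective L Jstar τ Kstar P
  refine ⟨_, ⟨ShimuraSetGS.mk L Jstar τ Kstar' v hv u, rfl⟩, ?_⟩
  -- the transition on complex points of the models: `M(f)(pts_K⁻¹ [z, bK]) = pts_{K′}⁻¹ [z, bK′]` (both embedded classes are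
  -- `[z, φGS(u)·]` with the same `z = 𝔹(B^τ(v ⊕ 0))`, ★ `ShimuraSetGS.embPoints_mk`)
  have hm : AlgPoints.map (R.M.map f) ((R.pts K).symm
      (ShimuraSetGS.embPoints L H τ T hT Jstar Jperp B ha hB hτa hτa' Kstar K.1.1 hK (ShimuraSetGS.mk L Jstar τ Kstar v hv u))) =
      (R.pts K').symm
        (ShimuraSetGS.embPoints L H τ T hT Jstar Jperp B ha hB hτa hτa' Kstar' K'.1.1 hK' (ShimuraSetGS.mk L Jstar τ Kstar' v hv u)) := by
    apply (R.pts K').injective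
    rw [Homeomorph.apply_symm_apply, ShimuraSetGS.embPoints_mk, ShimuraSetGS.embPoints_mk]
    exact R.map_pts K K' f _ _
  -- move along `baseChangeEquiv` (naturality) and read underlying points (`AlgPoints.pt_map`)
  have key : AlgPoints.map ((Motives.baseChangeHom τ).map (R.M.map f)) (AlgPoints.baseChangeEquiv τ (R.M.obj K) ((R.pts K).symm
      (ShimuraSetGS.embPoints L H τ T hT Jstar Jperp B ha hB hτa hτa' Kstar K.1.1 hK (ShimuraSetGS.mk L Jstar τ Kstar v hv u)))) =
      AlgPoints.baseChangeEquiv τ (R.M.obj K') ((R.pts K').symm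
        (ShimuraSetGS.embPoints L H τ T hT Jstar Jperp B ha hB hτa hτa' Kstar' K'.1.1 hK' (ShimuraSetGS.mk L Jstar τ Kstar' v hv u))) := by
    rw [map_baseChangeEquiv_eq, hm]
  exact congrArg AlgPoints.pt key.symm

set_option maxHeartbeats 400000 in -- instance-heavy adelic / Shimura-set statement: `whnf`/`isDefEq` time out at the default (as ★ `UnitaryShimuraCurveEmbeddedImageStable`)
/-- **Closed `L`-subschemes with the embedded closures as complex images are carried into each other by the transitions.**  If
`j : Z ↪ M_K` and `j′ : Z′ ↪ M_{K′}` are morphisms of `L`-schemes whose complexifications have underlying images the closures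
`C(K⋆, K)` and `C(K⋆′, K′)` of the embedded curve, then `M(f) ∘ j` lands (set-theoretically) in the image of `j′` for every transition
`f : K ⟶ K′` — the previous theorem read over `L` (an image inclusion may be checked after `- ⊗_L ℂ`, ★
`Motives.range_subset_of_baseChangeHom`).  This is the hypothesis under which transitions between REDUCED closed subschemes exist
uniquely (★ `Motives.exists_functor_of_forall_range_subset`). [cite: Deligne1971TravauxShimura, Variante 5.9 p. 157] [cite: StacksProject, Tag 01S1] -/
theorem RecordSystem.range_comp_map_subset_of_range_eq_closure_embPoints
    (Kstar Kstar' : Subgroup ↥(finAdelic (↥(maximalRealSubfield L)) L (IsCMField.complexConj L) 2 Jstar))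
    (K K' : C5.SmallLevel K₀') (f : K ⟶ K')
    (hK : Kstar.map (φGS L Jstar Jperp H B ha hB) ≤ K.1.1) (hK' : Kstar'.map (φGS L Jstar Jperp H B ha hB) ≤ K'.1.1)
    {Z Z' : SchemeOver L} (j : Z ⟶ R.M.obj K) (j' : Z' ⟶ R.M.obj K')
    (hj : letI : Algebra L ℂ := τ.toAlgebra
      Set.range ⇑((AbelianVariety.bcFunctor L ℂ).map j).left =
        closure (AlgPoints.pt '' Set.range fun P : ShimuraSetGS L Jstar τ Kstar =>
          AlgPoints.baseChangeEquiv τ (R.M.obj K) ((R.pts K).symm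
            (ShimuraSetGS.embPoints L H τ T hT Jstar Jperp B ha hB hτa hτa' Kstar K.1.1 hK P))))
    (hj' : letI : Algebra L ℂ := τ.toAlgebra
      Set.range ⇑((AbelianVariety.bcFunctor L ℂ).map j').left =
        closure (AlgPoints.pt '' Set.range fun P : ShimuraSetGS L Jstar τ Kstar' =>
          AlgPoints.baseChangeEquiv τ (R.M.obj K') ((R.pts K').symm
            (ShimuraSetGS.embPoints L H τ T hT Jstar Jperp B ha hB hτa hτa' Kstar' K'.1.1 hK' P)))) :
    Set.range ⇑(j ≫ R.M.map f).left ⊆ Set.range ⇑j'.left := by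
  letI : Algebra L ℂ := τ.toAlgebra
  refine range_subset_of_bcFunctor j' (j ≫ R.M.map f) ?_
  rw [hj', Functor.map_comp, Over.comp_left]
  rintro _ ⟨x, rfl⟩
  rw [Scheme.Hom.comp_apply]
  exact R.image_closure_embPoints_subset Jperp B ha hB hτa hτa' Kstar Kstar' K K' f hK hK'
    ⟨_, (Set.ext_iff.mp hj _).mp ⟨x, rfl⟩, rfl⟩

end Transition

/-! ### §2 The descended tower -/

section Tower

set_option maxHeartbeats 400000 in -- instance-heavy adelic / Shimura-set statement: `whnf`/`isDefEq` time out at the default (as ★ `UnitaryShimuraCurveEmbeddedImageStable`)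
/-- **R2-5 (tower half) — THE `L`-TOWER OF THE EMBEDDED UNITARY SHIMURA CURVE inside the surface's canonical model**
([Deligne1971TravauxShimura] Cor. 5.7 + Variante 5.9 for the sub-datum `(U(J⋆), 𝔻) ↪ (U(H), 𝔹²)`).  For the canonical model
`M` of the compact unitary Shimura SURFACE (a ★ `RecordSystem` over the CM field `L` along `τ`), a frame
`ᵗ(cB)·(a·H)·B = J⋆ ⊕ J⊥`, `J⋆` non-degenerate `c`-hermitian, and ANY functor of small levels `Tl : K⋆ ↦ Tl K⋆` with
`φGS(K⋆) ≤ Tl K⋆`: there are a functor `M⋆ : SmallLevel K₀⋆ ⥤ SchemeOver L` and a natural transformation `ι : M⋆ ⟶ Tl ⋙ M`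
of CLOSED IMMERSIONS such that, at every level, `(M⋆_{K⋆})_τ` is REDUCED and the underlying set of `ι_{K⋆} ⊗_{L,τ} ℂ` is EXACTLY
the Zariski closure `C(K⋆, Tl K⋆)` of the embedded curve `Sh_{K⋆}(U(J⋆))(ℂ) ↪ Sh_{Tl K⋆}(U(H))(ℂ) = (M_{Tl K⋆})_τ(ℂ)`.
Levelwise this is ★ `RecordSystem.exists_closedSubscheme_baseChange_range_eq_closure_embPoints` (Galois descent of the
`Aut(ℂ/τL)`-stable closure, `L` countable); the levels assemble into a functor because transitions between REDUCED closed
subschemes exist uniquely as soon as images are carried into images (★ `Motives.exists_functor_of_forall_range_subset`), which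
is §1 read over `L` through ★ `Motives.range_subset_of_baseChangeHom`.  No injectivity of `embPoints`, no scheme structure on
the curve and no torsion-freeness of levels is used.
[cite: Deligne1971TravauxShimura, Cor. 5.7 p. 156, Variante 5.9 p. 157] [cite: Milne2005ShimuraVarieties, Thm. 13.6 p. 118, Rem. 13.8 p. 119]
[cite: Margulis1991, Ch. I (0.11) p. 17] -/
theorem RecordSystem.exists_descendedTower
    {K₀star : C5.OpenCompactSubgroup ↥(finAdelic (↥(maximalRealSubfield L)) L (IsCMField.complexConj L) 2 Jstar)}
    (Tl : C5.SmallLevel K₀star ⥤ C5.SmallLevel K₀')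
    (hTl : ∀ Ks : C5.SmallLevel K₀star, Ks.1.1.map (φGS L Jstar Jperp H B ha hB) ≤ (Tl.obj Ks).1.1)
    (hJ : (Jstar.map (IsCMField.complexConj L))ᵀ = Jstar) (hdet : IsUnit Jstar.det) :
    letI : Algebra L ℂ := τ.toAlgebra
    ∃ (Mstar : C5.SmallLevel K₀star ⥤ SchemeOver L) (ι : ∀ Ks, Mstar.obj Ks ⟶ R.M.obj (Tl.obj Ks)),
      (∀ ⦃Ks Ks' : C5.SmallLevel K₀star⦄ (f : Ks ⟶ Ks'), Mstar.map f ≫ ι Ks' = ι Ks ≫ R.M.map (Tl.map f)) ∧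
      (∀ Ks, IsClosedImmersion (ι Ks).left) ∧
      (∀ Ks, IsReduced ((AbelianVariety.bcFunctor L ℂ).obj (Mstar.obj Ks)).left) ∧
      ∀ Ks, Set.range ⇑((AbelianVariety.bcFunctor L ℂ).map (ι Ks)).left =
        closure (AlgPoints.pt '' Set.range fun P : ShimuraSetGS L Jstar τ Ks.1.1 =>
          AlgPoints.baseChangeEquiv τ (R.M.obj (Tl.obj Ks)) ((R.pts (Tl.obj Ks)).symm
            (ShimuraSetGS.embPoints L H τ T hT Jstar Jperp B ha hB hτa hτa' Ks.1.1 (Tl.obj Ks).1.1 (hTl Ks) P))) := by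
  letI : Algebra L ℂ := τ.toAlgebra
  -- levelwise descent of the stable closure (R2-4)
  have hlev := fun Ks : C5.SmallLevel K₀star =>
    R.exists_closedSubscheme_baseChange_range_eq_closure_embPoints Jperp B ha hB hτa hτa' Ks.1.1 (Tl.obj Ks) (hTl Ks) hJ hdet
  choose Z j hj hred hrange using hlev
  haveI : ∀ Ks, IsClosedImmersion (j Ks).left := hj
  -- the descended levels are reduced (reducedness descends along `L → ℂ`)
  haveI hZred : ∀ Ks, IsReduced (Z Ks).left := by
    intro Ks
    haveI : IsReduced ((Motives.baseChangeHom (algebraMap L ℂ)).obj (Z Ks)).left :=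
      inferInstanceAs (IsReduced ((AbelianVariety.bcFunctor L ℂ).obj (Z Ks)).left)
    exact isReduced_of_baseChangeHom (algebraMap L ℂ) (Z Ks)
  -- the transitions of the surface tower carry `Z_{K⋆}` into `Z_{K⋆′}` over `L` (§1)
  have hr : ∀ ⦃Ks Ks' : C5.SmallLevel K₀star⦄ (f : Ks ⟶ Ks'),
      Set.range ⇑(j Ks ≫ R.M.map (Tl.map f)).left ⊆ Set.range ⇑(j Ks').left := fun Ks Ks' f =>
    R.range_comp_map_subset_of_range_eq_closure_embPoints Jperp B ha hB hτa hτa' Ks.1.1 Ks'.1.1 (Tl.obj Ks) (Tl.obj Ks')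
      (Tl.map f) (hTl Ks) (hTl Ks') (j Ks) (j Ks') (hrange Ks) (hrange Ks')
  -- assemble the `L`-tower (transitions between REDUCED closed subschemes are unique), componentwise over `M.obj (Tl K⋆)`
  obtain ⟨Mstar, ι, e, hnat, he⟩ := exists_functor_along_of_forall_range_subset Tl R.M Z j hr
  refine ⟨Mstar, ι, hnat, fun Ks => ?_, fun Ks => isReduced_bcFunctor_obj_of_iso (e Ks), fun Ks => ?_⟩
  · rw [← he Ks]
    exact isClosedImmersion_left_iso_hom_comp (e Ks) (j Ks)
  · rw [← he Ks, range_bcFunctor_map_iso_hom_comp]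
    exact hrange Ks

end Tower

end Literature.AlgebraicGeometry.ShimuraVarieties.UnitaryCanonicalModel

end
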